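import Summits.CriticalPhenomena.PercolationContinuityZ3.Theorems.PercNearOneGluingNoHeavyLowerTailKnQuestion8CoefficientwiseOffClusterGen
import HarnessLib

/-!
# The root-set kernel: the target-avoiding half of every kernel entry is nonnegative — prim-lf-2 gen 59

Support file (`--supports stmt-CriticalPhenomena-4575`, closed), prover `prim-lf-2` (gen 59).  No definitions, no named facts, no sorries; standard axioms.
Memo `prim-lf-2/CW-KERNEL-gen59.md` §6.1 (the discharge of the `y`-mixed atoms in the reduction schema NO-CORE ⟸ ATOM_r).

For a multigraph `ends : ι → Sym2 V`, an edge set `E`, root `x`, target `y`, and a root set `S' ∋ x`, write `C_x(s)` for the red cluster of `x` and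
`B_{S'}(s) = {v | ∃ a ∈ S', v ∈ C_a(E ∖ s)}` for the blue cluster of the SET `S'`.  The kernel entry `Φ({x}, S')` (memo CW-IGCEX-gen58 §8b) is the sum of
`T(s) = (f C_x(s) − f B_{S'}(s))·(g C_x(s) − g B_{S'}(s))` over the colourings with `¬(y ∈ C_x(s) ∧ y ∈ B_{S'}(s))`; it splits as the `y`-AVOIDING part (`y ∉ C_x(s)`) plus the part
`y ∈ C_x(s), y ∉ B_{S'}(s)`.
* `Coefficientwise.kernel_offTarget_nonneg` — **the `y`-avoiding part is `≥ 0`**: `0 ≤ Σ_{s ⊆ E : y ∉ C_x(s)} T(s)` for all monotone `f, g` and every `S' ∋ x`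
  (gen 55's `offCluster_twoColouring_nonneg_gen_sub` with `A = {y}` and the monotone majorants `F' = f ∘ R_{S'}`, `G' = g ∘ R_{S'}`, which dominate `f ∘ C_x`, `g ∘ C_x` because
  `C_x(t) ⊆ R_{S'}(t)`).  The other part is NOT signed (prim-lf-2 gen 59, `code/gen59/c/hybminus.c`: 11 600 / 23 296 `(G,y,S')` on 5 vertices), and `HYB = Φ({x},S') ≥ 0` stays a conjecture.
[cite: KozmaNitzan2024, Questions 8–9 (§5.5 p. 36) (context: the Question-8 pocket covariance programme)]
-/

namespace Summit.CriticalPhenomena.PercolationContinuityZ3.Theorems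

open Finset Literature.Probability.Percolation

namespace Coefficientwise

variable {ι V : Type*} [DecidableEq ι]

open Classical in
/-- **The target-avoiding half of a kernel entry is nonnegative**: for `x ∈ S'` and monotone `f, g`,
`0 ≤ Σ_{s ⊆ E : y ∉ C_x(s)} (f C_x(s) − f B_{S'}(s))·(g C_x(s) − g B_{S'}(s))`. [cite: KozmaNitzan2024, Questions 8–9 (§5.5 p. 36) (context)] -/
theorem kernel_offTarget_nonneg (ends : ι → Sym2 V) (E : Finset ι) (x y : V) (S' : Finset V) (hx : x ∈ S') (f g : Set V → ℝ)
    (hf : Monotone f) (hg : Monotone g) :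
    0 ≤ ∑ s ∈ E.powerset.filter (fun s : Finset ι => y ∉ openCluster (ends '' (↑s : Set ι)) x),
      (f (openCluster (ends '' (↑s : Set ι)) x) - f {v | ∃ a ∈ S', v ∈ openCluster (ends '' (↑(E \ s) : Set ι)) a}) *
        (g (openCluster (ends '' (↑s : Set ι)) x) - g {v | ∃ a ∈ S', v ∈ openCluster (ends '' (↑(E \ s) : Set ι)) a}) := by
  set RS' : Finset ι → Set V := fun t => {v | ∃ a ∈ S', v ∈ openCluster (ends '' (↑t : Set ι)) a} with hRS'
  have hmono : ∀ {t t' : Finset ι}, t ⊆ t' → RS' t ⊆ RS' t' := by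
    rintro t t' htt' v ⟨a, ha, hva⟩
    exact ⟨a, ha, openCluster_image_mono ends htt' a hva⟩
  have hdom : ∀ t : Finset ι, openCluster (ends '' (↑t : Set ι)) x ⊆ RS' t := fun t v hv => ⟨x, hx, hv⟩
  have key := offCluster_twoColouring_nonneg_gen_sub ends E x ({y} : Set V) f g (fun t => f (RS' t)) (fun t => g (RS' t)) hf hg
    (fun t t' htt' => hf (hmono htt')) (fun t t' htt' => hg (hmono htt')) (fun t _ => hf (hdom t)) (fun t _ => hg (hdom t))
  have hfilter : E.powerset.filter (fun t : Finset ι => ∀ a ∈ ({y} : Set V), a ∉ openCluster (ends '' (↑t : Set ι)) x) =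
      E.powerset.filter (fun s : Finset ι => y ∉ openCluster (ends '' (↑s : Set ι)) x) := by
    refine Finset.filter_congr fun t _ => ?_
    simp only [Set.mem_singleton_iff, forall_eq]
  rw [hfilter] at key
  exact key

end Coefficientwise

end Summit.CriticalPhenomena.PercolationContinuityZ3.Theorems
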